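import Summits.AtomisticToContinuum.FouriersLaw.Theses.ContactEchoEpochs

/-!
# Birth skeleton — crux `EquilibriumFluctuationWindow` (stmt-AtomisticToContinuum-11819)

Route `route-AtomisticToContinuum-ContactEchoEpochs`, sub-problem `FouriersLaw`.
BC3 skeleton (skeleton-register, planner one-shot 2026-08-17): four NAMED stubs and the
kernel-checked composition `EquilibriumFluctuationWindow_of` concluding the crux BY NAME.

Notation (all in the tree, inlined verbatim from the route file): `N = n + 2` sites,
`P = pinnedChain ω₂ lam β γ`, `μ_T = P.gibbsMeasure N T`, `P_t = P.transitionKernel N T T t`,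
contact powers `w_L = γ (T − p_0²)`, `w_R = γ (T − p_{N−1}²)` and the CONTACT ECHO
`c_N(t) = ∫ w_L · (P_t w_R) dμ_T`; the crux (W2) says
`∃ κ > 0, ∀ v > 0, ∀ a > 2, (N−1) T⁻² ∫_{[N/v, N^a]} c_N(t) dt → κ`.

The line is the route's own TWO-LAYER PLAN for W2 read literally
(`ScalingLimit → UniformIntegrability → W2`), cut along the three physical epochs INSIDE the
W2 window and the one regularity input the cut needs:

* `stub_echoLocallyIntegrable` (regularity, M): `t ↦ c_N(t)` is integrable on every compact
  window `[a, b] ⊂ [0, ∞)` (it is bounded by `2γ²T²`-type moment bounds via stationarity of `μ_T`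
  under the constructed kernels + Cauchy–Schwarz, and measurable in `t` by the joint measurability
  of the kernel) — needed to ADD the window integrals (set integrals of non-integrable functions
  are junk `0`).
* `stub_diffusiveWindowLimit` (LOAD-BEARING, open): the DIFFUSIVE SCALING LIMIT of the echo in
  integrated form — a kernel `K = K_T ∈ L¹(0, ∞)` with `∫₀^∞ K > 0` such that for all
  `0 < ε < A`, `(N−1) T⁻² ∫_{[εN², AN²]} c_N → ∫_{[ε, A]} K` (informally `N³ c_N(N² s) → T² K_T(s)`,
  `K_T` = contact-to-contact flux kernel of `∂_s e = κ ∂_x² e` on `[0,1]` with thermalising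
  Robin/Kapitza ends; `κ(T) := ∫₀^∞ K_T`).
* `stub_crossoverWindowSmall` (hyperbolic → diffusive crossover, L/XL): for every `v > 0` the
  absolute mass `(N−1) T⁻² ∫_{[N/v, εN²]} |c_N|` is eventually `≤ δ` once `ε ≤ ε₀(v, δ)` — no
  ballistic (sound-like) `Θ(1/N)` echo after the arrival time; FALSE at the harmonic corner
  `lam = β = 0`, so the anharmonic hypotheses are load-bearing here exactly as in the crux.
* `stub_lateWindowSmall` (diffusive → polynomial times, L/XL): for every `a > 2` the absolute
  mass `(N−1) T⁻² ∫_{[AN², N^a]} |c_N|` is eventually `≤ δ` once `A ≥ A₀(a, δ)` — the echo has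
  relaxed on the diffusive scale `e^{−c t/N²}` with no `Θ(1/N)` mass parked at polynomial times
  (the `∀ a` clause of the crux).

`EquilibriumFluctuationWindow_of : Sig.stub_echoLocallyIntegrable → Sig.stub_diffusiveWindowLimit →
Sig.stub_crossoverWindowSmall → Sig.stub_lateWindowSmall → EquilibriumFluctuationWindow` (no sorry)
= `κ := ∫₀^∞ K`; for `δ > 0` choose `ε` (crossover threshold, continuity of the primitive of `K`
at `0`) and `A` (late threshold, `∫₀^A K → ∫₀^∞ K`), then for `N` large
`N/v ≤ εN² ≤ AN² ≤ N^a`, split `∫_{[N/v, N^a]} = ∫_{[N/v, εN²]} + ∫_{[εN², AN²]} + ∫_{[AN², N^a]}`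
(interval-integral additivity, from stub 1) and squeeze: `δ/5 + δ/5 + 2δ/5 + δ/5`.
The real analysis is isolated in the abstract lemma `tendsto_window_of_epochs`
(arbitrary `c : ℕ → ℝ → ℝ`, `K : ℝ → ℝ`), ~110 lines.

File map: §0 the abstract three-epoch lemma; §1 `Sig.stub_<name> : Prop` — the four stub
STATEMENTS (named, so that the composition's hypotheses are the declared stubs BY NAME);
§2 `theorem stub_<name> : <statement verbatim> := by sorry` — the registered stubs (the ONLY
sorries); §3 `EquilibriumFluctuationWindow_of` — the composition, the unique declaration concluding
the crux; §4 an `example` instantiating it through the sorried stubs.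

Disproof used: none — no `Disproof.lean` / Negative lemma is filed on this crux
(`ledger crux ls stmt-AtomisticToContinuum-11819`: no workfiles, 2026-08-17); the negatives index of
the summit has no statement in the W2 family (route header). Calibration honoured: the refuter's
harmonic-corner computation (W2 false at `lam = β = 0`, `(N−1) G_N ∼ 0.125 N`) is carried by
`stub_crossoverWindowSmall` (ballistic echo just after arrival), which keeps `lam, β > 0`.
-/

open MeasureTheory Filter Set Topology

namespace Summit.AtomisticToContinuum.FouriersLaw.Cruxes.EquilibriumFluctuationWindow.Birth

open Summit.AtomisticToContinuum.FouriersLaw.Theses.ContactEchoEpochs (EquilibriumFluctuationWindow)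

/-! ## §0 The abstract three-epoch lemma (pure real analysis, no chain) -/

/-- THREE-EPOCH SQUEEZE. Let `c n : ℝ → ℝ` be locally integrable on `[0, ∞)` and `K ∈ L¹(0,∞)`.
If the diffusive windows converge, `p_n ∫_{[εN², AN²]} c_n → ∫_{[ε,A]} K` for all `0 < ε < A`
(`N = n + 2`, `p_n = (n+1)/T²`), and the crossover windows `[N/v, εN²]` resp. late windows
`[AN², N^a]` carry absolute mass eventually `≤ δ` once `ε ≤ ε₀(δ)` resp. `A ≥ A₀(δ)`, then
`p_n ∫_{[N/v, N^a]} c_n → ∫_{(0,∞)} K`. -/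
theorem tendsto_window_of_epochs {c : ℕ → ℝ → ℝ} {K : ℝ → ℝ} {T v a : ℝ}
    (hv : 0 < v) (ha : 2 < a)
    (hInt : ∀ n : ℕ, ∀ lo hi : ℝ, 0 ≤ lo → IntegrableOn (c n) (Set.Icc lo hi))
    (hK : IntegrableOn K (Set.Ioi 0))
    (hmid : ∀ ε A : ℝ, 0 < ε → ε < A →
      Tendsto (fun n : ℕ => ((n : ℝ) + 1) / T ^ 2 *
        ∫ t in Set.Icc (ε * ((n : ℝ) + 2) ^ 2) (A * ((n : ℝ) + 2) ^ 2), c n t)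
        atTop (𝓝 (∫ s in Set.Icc ε A, K s)))
    (hearly : ∀ δ : ℝ, 0 < δ → ∃ ε₀ : ℝ, 0 < ε₀ ∧ ∀ ε : ℝ, 0 < ε → ε ≤ ε₀ →
      ∀ᶠ n : ℕ in atTop, ((n : ℝ) + 1) / T ^ 2 *
        (∫ t in Set.Icc (((n : ℝ) + 2) / v) (ε * ((n : ℝ) + 2) ^ 2), |c n t|) ≤ δ)
    (hlate : ∀ δ : ℝ, 0 < δ → ∃ A₀ : ℝ, 0 < A₀ ∧ ∀ A : ℝ, A₀ ≤ A →
      ∀ᶠ n : ℕ in atTop, ((n : ℝ) + 1) / T ^ 2 *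
        (∫ t in Set.Icc (A * ((n : ℝ) + 2) ^ 2) (((n : ℝ) + 2) ^ a), |c n t|) ≤ δ) :
    Tendsto (fun n : ℕ => ((n : ℝ) + 1) / T ^ 2 *
      ∫ t in Set.Icc (((n : ℝ) + 2) / v) (((n : ℝ) + 2) ^ a), c n t)
      atTop (𝓝 (∫ s in Set.Ioi 0, K s)) := by
  rw [Metric.tendsto_nhds]
  intro δ hδ
  have hδ5 : 0 < δ / 5 := by positivity
  -- (1) the two tails of `K`: `∫₀^A K → ∫_{(0,∞)} K` and `∫₀^ε K → 0`
  have hR : Tendsto (fun A : ℝ => ∫ s in (0 : ℝ)..A, K s) atTop (𝓝 (∫ s in Set.Ioi 0, K s)) :=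
    MeasureTheory.intervalIntegral_tendsto_integral_Ioi 0 hK tendsto_id
  obtain ⟨A₁, hA₁⟩ := Metric.tendsto_atTop.1 hR (δ / 5) hδ5
  have hK01 : IntervalIntegrable K volume 0 1 :=
    (intervalIntegrable_iff_integrableOn_Ioc_of_le zero_le_one).2
      (hK.mono_set Set.Ioc_subset_Ioi_self)
  have hcont : ContinuousOn (fun b => ∫ s in (0 : ℝ)..b, K s) (Set.uIcc (0 : ℝ) 1) :=
    intervalIntegral.continuousOn_primitive_interval' hK01 Set.left_mem_uIcc
  have hL : Tendsto (fun b => ∫ s in (0 : ℝ)..b, K s) (𝓝[Set.uIcc (0 : ℝ) 1] 0) (𝓝 0) := by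
    have h := (hcont.continuousWithinAt Set.left_mem_uIcc).tendsto
    simpa only [intervalIntegral.integral_same] using h
  obtain ⟨η, hη, hη'⟩ := Metric.tendsto_nhdsWithin_nhds.1 hL (δ / 5) hδ5
  -- (2) thresholds from the crossover and the late windows
  obtain ⟨ε₀, hε₀, hE⟩ := hearly (δ / 5) hδ5
  obtain ⟨A₀, hA₀, hLt⟩ := hlate (δ / 5) hδ5
  -- (3) choice of `ε` and `A`
  obtain ⟨ε, hεpos, hεε₀, hεη, hε1⟩ : ∃ ε : ℝ, 0 < ε ∧ ε ≤ ε₀ ∧ ε < η ∧ ε ≤ 1 :=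
    ⟨min ε₀ (min (η / 2) 1), lt_min hε₀ (lt_min (half_pos hη) one_pos), min_le_left _ _,
      lt_of_le_of_lt ((min_le_right _ _).trans (min_le_left _ _)) (half_lt_self hη),
      (min_le_right _ _).trans (min_le_right _ _)⟩
  obtain ⟨A, hAA₀, hAA₁, hεA⟩ : ∃ A : ℝ, A₀ ≤ A ∧ A₁ ≤ A ∧ ε < A :=
    ⟨max A₀ (max A₁ 2), le_max_left _ _, (le_max_left _ _).trans (le_max_right _ _),
      lt_of_le_of_lt hε1
        (lt_of_lt_of_le one_lt_two ((le_max_right _ _).trans (le_max_right _ _)))⟩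
  have hApos : 0 < A := hεpos.trans hεA
  -- (4) `K` on the middle window is within `2δ/5` of `∫_{(0,∞)} K`
  have hKmid : |(∫ s in Set.Icc ε A, K s) - ∫ s in Set.Ioi 0, K s| < 2 * (δ / 5) := by
    have h0A : IntervalIntegrable K volume 0 A :=
      (intervalIntegrable_iff_integrableOn_Ioc_of_le hApos.le).2
        (hK.mono_set Set.Ioc_subset_Ioi_self)
    have h0ε : IntervalIntegrable K volume 0 ε :=
      (intervalIntegrable_iff_integrableOn_Ioc_of_le hεpos.le).2
        (hK.mono_set Set.Ioc_subset_Ioi_self)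
    have hsplitK : ∫ s in Set.Icc ε A, K s =
        (∫ s in (0 : ℝ)..A, K s) - ∫ s in (0 : ℝ)..ε, K s := by
      rw [intervalIntegral.integral_interval_sub_left h0A h0ε,
        intervalIntegral.integral_of_le hεA.le, MeasureTheory.integral_Icc_eq_integral_Ioc]
    have h1 : |(∫ s in (0 : ℝ)..A, K s) - ∫ s in Set.Ioi 0, K s| < δ / 5 := by
      have := hA₁ A hAA₁
      rwa [Real.dist_eq] at this
    have h2 : |∫ s in (0 : ℝ)..ε, K s| < δ / 5 := by
      have hmem : ε ∈ Set.uIcc (0 : ℝ) 1 := by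
        rw [Set.uIcc_of_le zero_le_one]
        exact ⟨hεpos.le, hε1⟩
      have hdist : dist ε 0 < η := by
        rw [Real.dist_eq, sub_zero, abs_of_pos hεpos]
        exact hεη
      have := hη' hmem hdist
      rwa [Real.dist_eq, sub_zero] at this
    rw [hsplitK]
    rw [abs_lt] at h1 h2 ⊢
    constructor <;> linarith [h1.1, h1.2, h2.1, h2.2]
  -- (5) eventual ordering of the cut points and the three eventual window estimates
  have hN : Tendsto (fun n : ℕ => (n : ℝ) + 2) atTop atTop :=
    tendsto_atTop_add_const_right _ _ tendsto_natCast_atTop_atTop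
  have hev1 : ∀ᶠ n : ℕ in atTop, 1 / (ε * v) ≤ (n : ℝ) + 2 :=
    hN.eventually (eventually_ge_atTop _)
  have hev2 : ∀ᶠ n : ℕ in atTop, A ≤ ((n : ℝ) + 2) ^ (a - 2) :=
    ((tendsto_rpow_atTop (by linarith : (0 : ℝ) < a - 2)).comp hN).eventually
      (eventually_ge_atTop _)
  have hev3 := hE ε hεpos hεε₀
  have hev4 := hLt A hAA₀
  have hev5 := Metric.tendsto_nhds.1 (hmid ε A hεpos hεA) (δ / 5) hδ5
  filter_upwards [hev1, hev2, hev3, hev4, hev5] with n h1 h2 h3 h4 h5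
  show dist (((n : ℝ) + 1) / T ^ 2 *
      ∫ t in Set.Icc (((n : ℝ) + 2) / v) (((n : ℝ) + 2) ^ a), c n t) (∫ s in Set.Ioi 0, K s) < δ
  -- (6) the estimate at a fixed large `n`
  have hNpos : 0 < (n : ℝ) + 2 := by positivity
  have hp : 0 ≤ ((n : ℝ) + 1) / T ^ 2 := by positivity
  have hlo : 0 ≤ ((n : ℝ) + 2) / v := div_nonneg hNpos.le hv.le
  have hle1 : ((n : ℝ) + 2) / v ≤ ε * ((n : ℝ) + 2) ^ 2 := by
    rw [div_le_iff₀ hv]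
    have h := (div_le_iff₀ (mul_pos hεpos hv)).1 h1
    nlinarith [mul_le_mul_of_nonneg_left h hNpos.le]
  have hle2 : ε * ((n : ℝ) + 2) ^ 2 ≤ A * ((n : ℝ) + 2) ^ 2 :=
    mul_le_mul_of_nonneg_right hεA.le (sq_nonneg _)
  have hle3 : A * ((n : ℝ) + 2) ^ 2 ≤ ((n : ℝ) + 2) ^ a := by
    have hpow : ((n : ℝ) + 2) ^ a = ((n : ℝ) + 2) ^ (a - 2) * ((n : ℝ) + 2) ^ 2 := by
      rw [← Real.rpow_two, ← Real.rpow_add hNpos, sub_add_cancel]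
    rw [hpow]
    exact mul_le_mul_of_nonneg_right h2 (sq_nonneg _)
  have hi1 : IntervalIntegrable (c n) volume (((n : ℝ) + 2) / v) (ε * ((n : ℝ) + 2) ^ 2) := by
    refine MeasureTheory.IntegrableOn.intervalIntegrable ?_
    rw [Set.uIcc_of_le hle1]
    exact hInt n _ _ hlo
  have hi2 : IntervalIntegrable (c n) volume (ε * ((n : ℝ) + 2) ^ 2) (A * ((n : ℝ) + 2) ^ 2) := by
    refine MeasureTheory.IntegrableOn.intervalIntegrable ?_
    rw [Set.uIcc_of_le hle2]
    exact hInt n _ _ (hlo.trans hle1)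
  have hi3 : IntervalIntegrable (c n) volume (A * ((n : ℝ) + 2) ^ 2) (((n : ℝ) + 2) ^ a) := by
    refine MeasureTheory.IntegrableOn.intervalIntegrable ?_
    rw [Set.uIcc_of_le hle3]
    exact hInt n _ _ ((hlo.trans hle1).trans hle2)
  -- split the crux window into crossover + diffusive + late windows
  have hsplit : ∫ t in Set.Icc (((n : ℝ) + 2) / v) (((n : ℝ) + 2) ^ a), c n t =
      (∫ t in Set.Icc (((n : ℝ) + 2) / v) (ε * ((n : ℝ) + 2) ^ 2), c n t) +
      (∫ t in Set.Icc (ε * ((n : ℝ) + 2) ^ 2) (A * ((n : ℝ) + 2) ^ 2), c n t) +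
      ∫ t in Set.Icc (A * ((n : ℝ) + 2) ^ 2) (((n : ℝ) + 2) ^ a), c n t := by
    simp only [MeasureTheory.integral_Icc_eq_integral_Ioc]
    rw [← intervalIntegral.integral_of_le (hle1.trans (hle2.trans hle3)),
      ← intervalIntegral.integral_of_le hle1, ← intervalIntegral.integral_of_le hle2,
      ← intervalIntegral.integral_of_le hle3,
      intervalIntegral.integral_add_adjacent_intervals hi1 hi2,
      intervalIntegral.integral_add_adjacent_intervals (hi1.trans hi2) hi3]
  have hI1 : |((n : ℝ) + 1) / T ^ 2 *
      ∫ t in Set.Icc (((n : ℝ) + 2) / v) (ε * ((n : ℝ) + 2) ^ 2), c n t| ≤ δ / 5 := by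
    rw [abs_mul, abs_of_nonneg hp]
    exact (mul_le_mul_of_nonneg_left MeasureTheory.abs_integral_le_integral_abs hp).trans h3
  have hI3 : |((n : ℝ) + 1) / T ^ 2 *
      ∫ t in Set.Icc (A * ((n : ℝ) + 2) ^ 2) (((n : ℝ) + 2) ^ a), c n t| ≤ δ / 5 := by
    rw [abs_mul, abs_of_nonneg hp]
    exact (mul_le_mul_of_nonneg_left MeasureTheory.abs_integral_le_integral_abs hp).trans h4
  have hI2 : |((n : ℝ) + 1) / T ^ 2 *
      (∫ t in Set.Icc (ε * ((n : ℝ) + 2) ^ 2) (A * ((n : ℝ) + 2) ^ 2), c n t) -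
        ∫ s in Set.Icc ε A, K s| < δ / 5 := by
    rw [← Real.dist_eq]
    exact h5
  rw [Real.dist_eq, hsplit, mul_add, mul_add]
  rw [abs_le] at hI1 hI3
  rw [abs_lt] at hI2 hKmid ⊢
  constructor <;> linarith [hI1.1, hI1.2, hI2.1, hI2.2, hI3.1, hI3.2, hKmid.1, hKmid.2]

/-! ## §1 The stub statements (named) -/

/-- Statement of `stub_echoLocallyIntegrable` (regularity: the echo is integrable in time on
compact windows of `[0, ∞)`). -/
def Sig.stub_echoLocallyIntegrable : Prop :=
    ∀ ω₂ lam β γ : ℝ, 0 < ω₂ → 0 < lam → 0 < β → 0 < γ → ∀ T : ℝ, 0 < T → ∀ n : ℕ,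
      ∀ a b : ℝ, 0 ≤ a →
        MeasureTheory.IntegrableOn (fun t : ℝ => (∫ z, γ * (T - (z.2 0) ^ 2) * (∫ y, γ * (T - (y.2 (Fin.last (n + 1))) ^ 2) ∂((Literature.MathematicalPhysics.KineticTheory.HeatConduction.pinnedChain ω₂ lam β γ).transitionKernel (n + 2) T T (Real.toNNReal t) z)) ∂((Literature.MathematicalPhysics.KineticTheory.HeatConduction.pinnedChain ω₂ lam β γ).gibbsMeasure (n + 2) T))) (Set.Icc a b)

/-- Statement of `stub_diffusiveWindowLimit` (LOAD-BEARING: the diffusive scaling limit of the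
echo in integrated form, with its `L¹` kernel `K_T` and `κ(T) := ∫₀^∞ K_T > 0`). -/
def Sig.stub_diffusiveWindowLimit : Prop :=
    ∀ ω₂ lam β γ : ℝ, 0 < ω₂ → 0 < lam → 0 < β → 0 < γ → ∀ T : ℝ, 0 < T →
      ∃ K : ℝ → ℝ, MeasureTheory.IntegrableOn K (Set.Ioi 0) ∧ 0 < (∫ s in Set.Ioi (0 : ℝ), K s) ∧
        ∀ ε A : ℝ, 0 < ε → ε < A →
          Filter.Tendsto (fun n : ℕ => ((n : ℝ) + 1) / T ^ 2 * ∫ t in Set.Icc (ε * ((n : ℝ) + 2) ^ 2) (A * ((n : ℝ) + 2) ^ 2), (∫ z, γ * (T - (z.2 0) ^ 2) * (∫ y, γ * (T - (y.2 (Fin.last (n + 1))) ^ 2) ∂((Literature.MathematicalPhysics.KineticTheory.HeatConduction.pinnedChain ω₂ lam β γ).transitionKernel (n + 2) T T (Real.toNNReal t) z)) ∂((Literature.MathematicalPhysics.KineticTheory.HeatConduction.pinnedChain ω₂ lam β γ).gibbsMeasure (n + 2) T))) Filter.atTop (nhds (∫ s in Set.Icc ε A, K s))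

/-- Statement of `stub_crossoverWindowSmall` (hyperbolic-to-diffusive crossover: no ballistic
echo after arrival — uniform smallness of the absolute mass on `[N/v, εN²]`). -/
def Sig.stub_crossoverWindowSmall : Prop :=
    ∀ ω₂ lam β γ : ℝ, 0 < ω₂ → 0 < lam → 0 < β → 0 < γ → ∀ T : ℝ, 0 < T →
      ∀ v : ℝ, 0 < v → ∀ δ : ℝ, 0 < δ → ∃ ε₀ : ℝ, 0 < ε₀ ∧ ∀ ε : ℝ, 0 < ε → ε ≤ ε₀ →
        ∀ᶠ n : ℕ in Filter.atTop, ((n : ℝ) + 1) / T ^ 2 * (∫ t in Set.Icc (((n : ℝ) + 2) / v) (ε * ((n : ℝ) + 2) ^ 2), |(∫ z, γ * (T - (z.2 0) ^ 2) * (∫ y, γ * (T - (y.2 (Fin.last (n + 1))) ^ 2) ∂((Literature.MathematicalPhysics.KineticTheory.HeatConduction.pinnedChain ω₂ lam β γ).transitionKernel (n + 2) T T (Real.toNNReal t) z)) ∂((Literature.MathematicalPhysics.KineticTheory.HeatConduction.pinnedChain ω₂ lam β γ).gibbsMeasure (n + 2) T))|) ≤ δ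

/-- Statement of `stub_lateWindowSmall` (diffusive-to-polynomial times: the echo has relaxed —
uniform smallness of the absolute mass on `[AN², N^a]`). -/
def Sig.stub_lateWindowSmall : Prop :=
    ∀ ω₂ lam β γ : ℝ, 0 < ω₂ → 0 < lam → 0 < β → 0 < γ → ∀ T : ℝ, 0 < T →
      ∀ a : ℝ, 2 < a → ∀ δ : ℝ, 0 < δ → ∃ A₀ : ℝ, 0 < A₀ ∧ ∀ A : ℝ, A₀ ≤ A →
        ∀ᶠ n : ℕ in Filter.atTop, ((n : ℝ) + 1) / T ^ 2 * (∫ t in Set.Icc (A * ((n : ℝ) + 2) ^ 2) (((n : ℝ) + 2) ^ a), |(∫ z, γ * (T - (z.2 0) ^ 2) * (∫ y, γ * (T - (y.2 (Fin.last (n + 1))) ^ 2) ∂((Literature.MathematicalPhysics.KineticTheory.HeatConduction.pinnedChain ω₂ lam β γ).transitionKernel (n + 2) T T (Real.toNNReal t) z)) ∂((Literature.MathematicalPhysics.KineticTheory.HeatConduction.pinnedChain ω₂ lam β γ).gibbsMeasure (n + 2) T))|) ≤ δ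

/-! ## §2 The registered stubs (the only `sorry`s of the file) -/

/-- STUB 1 (regularity; size M, provable now in kind). LOCAL INTEGRABILITY OF THE ECHO IN TIME:
for every `N = n + 2` and every compact window `[a, b]` with `a ≥ 0`, `t ↦ c_N(t)` is
Lebesgue-integrable on `[a, b]`. Why plausibly true: `|c_N(t)| ≤ ‖w_L‖_{L²(μ_T)} ‖P_t w_R‖_{L²(μ_T)}
≤ ‖w_L‖₂ ‖w_R‖₂ = 2γ²T²` (Gaussian momentum marginals of `μ_T`; `P_t` a contraction of `L²(μ_T)` by
stationarity of the Gibbs measure under the constructed Langevin kernels), and `t ↦ c_N(t)` is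
measurable by the joint measurability of `(t, x) ↦ P_t(x, ·)`. Leans on:
`OscillatorChain.transitionKernel` / `gibbsMeasure` (LangevinChainKernel / LangevinChainGibbs),
invariance of `gibbsMeasure` under the kernel. [CuneoEckmannHairerReyBellet2018 §2; Carmona2007] -/
theorem stub_echoLocallyIntegrable :
    ∀ ω₂ lam β γ : ℝ, 0 < ω₂ → 0 < lam → 0 < β → 0 < γ → ∀ T : ℝ, 0 < T → ∀ n : ℕ,
      ∀ a b : ℝ, 0 ≤ a →
        MeasureTheory.IntegrableOn (fun t : ℝ => (∫ z, γ * (T - (z.2 0) ^ 2) * (∫ y, γ * (T - (y.2 (Fin.last (n + 1))) ^ 2) ∂((Literature.MathematicalPhysics.KineticTheory.HeatConduction.pinnedChain ω₂ lam β γ).transitionKernel (n + 2) T T (Real.toNNReal t) z)) ∂((Literature.MathematicalPhysics.KineticTheory.HeatConduction.pinnedChain ω₂ lam β γ).gibbsMeasure (n + 2) T))) (Set.Icc a b) := by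
  sorry

/-- STUB 2 (LOAD-BEARING; open — the corner where `κ(T)` is defined). DIFFUSIVE SCALING LIMIT
OF THE CONTACT ECHO, integrated form: for all parameters `> 0` and `T > 0` there is a kernel
`K = K_T : ℝ → ℝ`, integrable on `(0, ∞)` with `∫₀^∞ K > 0`, such that for all `0 < ε < A`,
`(N−1) T⁻² ∫_{[εN², AN²]} c_N(t) dt → ∫_{[ε, A]} K(s) ds` as `N → ∞`. Informally
`N³ c_N(N² s) → T² K_T(s)` where `K_T` is the contact-to-contact flux kernel of the heat equation
`∂_s e = κ ∂_x² e` on `[0,1]` with thermalising (Robin/Kapitza) boundary conditions — an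
EQUILIBRIUM energy-fluctuation limit for two boundary observables of the OPEN chain
(Ornstein–Uhlenbeck limit of the energy fluctuation field + a Boltzmann–Gibbs principle for
`w_L, w_R`), on COMPACT diffusive time windows only (the crossover and late windows are the other
two stubs). Why it might fail: Boltzmann–Gibbs for a DETERMINISTIC anharmonic bulk is open even
at equilibrium (MacroErgodicity class); the Kapitza boundary condition is identified in print
only for harmonic/noisy chains. [Bernardin2014 §3, KomorowskiOlla2020, KomorowskiOlla2021,
KomorowskiOllaSimon2021, arXiv:2310.13338, BonettoLebowitzReyBellet2000 §5.3] -/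
theorem stub_diffusiveWindowLimit :
    ∀ ω₂ lam β γ : ℝ, 0 < ω₂ → 0 < lam → 0 < β → 0 < γ → ∀ T : ℝ, 0 < T →
      ∃ K : ℝ → ℝ, MeasureTheory.IntegrableOn K (Set.Ioi 0) ∧ 0 < (∫ s in Set.Ioi (0 : ℝ), K s) ∧
        ∀ ε A : ℝ, 0 < ε → ε < A →
          Filter.Tendsto (fun n : ℕ => ((n : ℝ) + 1) / T ^ 2 * ∫ t in Set.Icc (ε * ((n : ℝ) + 2) ^ 2) (A * ((n : ℝ) + 2) ^ 2), (∫ z, γ * (T - (z.2 0) ^ 2) * (∫ y, γ * (T - (y.2 (Fin.last (n + 1))) ^ 2) ∂((Literature.MathematicalPhysics.KineticTheory.HeatConduction.pinnedChain ω₂ lam β γ).transitionKernel (n + 2) T T (Real.toNNReal t) z)) ∂((Literature.MathematicalPhysics.KineticTheory.HeatConduction.pinnedChain ω₂ lam β γ).gibbsMeasure (n + 2) T))) Filter.atTop (nhds (∫ s in Set.Icc ε A, K s)) := by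
  sorry

/-- STUB 3 (hyperbolic → diffusive crossover; size L/XL). NO BALLISTIC ECHO AFTER ARRIVAL:
for every `v > 0` and `δ > 0` there is `ε₀ > 0` such that for every `0 < ε ≤ ε₀`, eventually in
`N`, `(N−1) T⁻² ∫_{[N/v, εN²]} |c_N(t)| dt ≤ δ` — i.e. `limsup_N` of the absolute crossover mass
tends to `0` as `ε ↓ 0` (uniform integrability of `(N−1)|c_N|` at small diffusive times). Why
plausibly true: pinning kills the sound mode, so after the Lieb–Robinson arrival time the echo
builds up only diffusively (`N³ c_N(N² s) ≈ T² K_T(s)` with `K_T(s) → 0` rapidly as `s ↓ 0`);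
why it might fail: it is FALSE at the harmonic corner `lam = β = 0` (ballistic `Θ(1/N)` echo at
`t ≈ N / v_sound`; refuter calibration `(N−1) G_N ∼ 0.125 N`), so the anharmonic hypotheses are
load-bearing, and long-lived near-sonic phonon packets at low temperature could carry mass just
after arrival. [ButtaEtAl2007, RazSims2009, Bernardin2014, KomorowskiOlla2020,
Literature.Barriers.AtomisticToContinuum.HarmonicChainBallisticFlux] -/
theorem stub_crossoverWindowSmall :
    ∀ ω₂ lam β γ : ℝ, 0 < ω₂ → 0 < lam → 0 < β → 0 < γ → ∀ T : ℝ, 0 < T →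
      ∀ v : ℝ, 0 < v → ∀ δ : ℝ, 0 < δ → ∃ ε₀ : ℝ, 0 < ε₀ ∧ ∀ ε : ℝ, 0 < ε → ε ≤ ε₀ →
        ∀ᶠ n : ℕ in Filter.atTop, ((n : ℝ) + 1) / T ^ 2 * (∫ t in Set.Icc (((n : ℝ) + 2) / v) (ε * ((n : ℝ) + 2) ^ 2), |(∫ z, γ * (T - (z.2 0) ^ 2) * (∫ y, γ * (T - (y.2 (Fin.last (n + 1))) ^ 2) ∂((Literature.MathematicalPhysics.KineticTheory.HeatConduction.pinnedChain ω₂ lam β γ).transitionKernel (n + 2) T T (Real.toNNReal t) z)) ∂((Literature.MathematicalPhysics.KineticTheory.HeatConduction.pinnedChain ω₂ lam β γ).gibbsMeasure (n + 2) T))|) ≤ δ := by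
  sorry

/-- STUB 4 (diffusive → polynomial times; size L/XL). THE ECHO HAS RELAXED BEFORE POLYNOMIAL
TIMES: for every `a > 2` and `δ > 0` there is `A₀ > 0` such that for every `A ≥ A₀`, eventually in
`N`, `(N−1) T⁻² ∫_{[AN², N^a]} |c_N(t)| dt ≤ δ` — `limsup_N` of the absolute late mass tends to
`0` as `A → ∞`. Why plausibly true: on the diffusive scale the open chain with thermalising ends
loses its energy fluctuations exponentially (`N³ c_N(N² s) ≲ e^{−c s}`, lowest Robin eigenvalue of
`κ ∂_x²` on `[0,1]`), and an `L²(μ_T)` decay `‖P_t w_R‖₂ ≤ C N^m e^{−c t/N²}`-type bound for the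
contact observable up to times `N^a` gives the window; why it might fail: metastable high-energy
(breather-like) states or a spectral gap closing faster than `N^{−2}` for quadratic observables
could park `Θ(1/N)` absolute mass at times `N² ≪ t ≤ N^a` (the `∀ a` clause of the crux).
[BeckerMenegaki2022, Menegaki2020, CuneoEckmannHairerReyBellet2018, HairerMattingly2009,
Literature.Barriers.AtomisticToContinuum.BeckerMenegaki2022_gapClosing] -/
theorem stub_lateWindowSmall :
    ∀ ω₂ lam β γ : ℝ, 0 < ω₂ → 0 < lam → 0 < β → 0 < γ → ∀ T : ℝ, 0 < T →
      ∀ a : ℝ, 2 < a → ∀ δ : ℝ, 0 < δ → ∃ A₀ : ℝ, 0 < A₀ ∧ ∀ A : ℝ, A₀ ≤ A →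
        ∀ᶠ n : ℕ in Filter.atTop, ((n : ℝ) + 1) / T ^ 2 * (∫ t in Set.Icc (A * ((n : ℝ) + 2) ^ 2) (((n : ℝ) + 2) ^ a), |(∫ z, γ * (T - (z.2 0) ^ 2) * (∫ y, γ * (T - (y.2 (Fin.last (n + 1))) ^ 2) ∂((Literature.MathematicalPhysics.KineticTheory.HeatConduction.pinnedChain ω₂ lam β γ).transitionKernel (n + 2) T T (Real.toNNReal t) z)) ∂((Literature.MathematicalPhysics.KineticTheory.HeatConduction.pinnedChain ω₂ lam β γ).gibbsMeasure (n + 2) T))|) ≤ δ := by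
  sorry

/-! ## §3 The composition -/

/-- COMPOSITION (kernel-checked, no sorry): the four stubs, BY NAME, give the crux
`Summit.AtomisticToContinuum.FouriersLaw.Theses.ContactEchoEpochs.EquilibriumFluctuationWindow`.
Proof: `κ(T) := ∫_{(0,∞)} K_T` from stub 2 (positive by stub 2); for `v > 0`, `a > 2` the crux
window `[N/v, N^a]` is the union of the crossover, diffusive and late windows once
`N/v ≤ εN² ≤ AN² ≤ N^a`; the three-epoch squeeze `tendsto_window_of_epochs` (additivity from stub 1,
middle limit from stub 2, outer masses from stubs 3–4, tails of `K_T` by real analysis). -/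
theorem EquilibriumFluctuationWindow_of :
    Sig.stub_echoLocallyIntegrable → Sig.stub_diffusiveWindowLimit → Sig.stub_crossoverWindowSmall →
      Sig.stub_lateWindowSmall → EquilibriumFluctuationWindow := by
  intro h1 h2 h3 h4 ω₂ lam β γ hω hl hβ hγ T hT
  obtain ⟨K, hK, hKpos, hmid⟩ := h2 ω₂ lam β γ hω hl hβ hγ T hT
  refine ⟨∫ s in Set.Ioi 0, K s, hKpos, fun v hv a ha => ?_⟩
  exact tendsto_window_of_epochs hv ha (h1 ω₂ lam β γ hω hl hβ hγ T hT) hK hmid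
    (h3 ω₂ lam β γ hω hl hβ hγ T hT v hv) (h4 ω₂ lam β γ hω hl hβ hγ T hT a ha)

/-! ## §4 Instantiation through the sorried stubs (an `example`: registers nothing and leaves
`EquilibriumFluctuationWindow_of` the unique declaration concluding the crux) -/

example : EquilibriumFluctuationWindow :=
  EquilibriumFluctuationWindow_of stub_echoLocallyIntegrable stub_diffusiveWindowLimit
    stub_crossoverWindowSmall stub_lateWindowSmall

end Summit.AtomisticToContinuum.FouriersLaw.Cruxes.EquilibriumFluctuationWindow.Birth
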